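import Literature.NumberTheory.Automorphic.UnitaryGroupDualPairCarriers
import HarnessLib

/-!
# Direct sums on the group side of the see-saw: `Sp(𝕎₁) × Sp(𝕎₂) → Sp(𝕎₁ ⊕ 𝕎₂)`,
# `U(H₁) × U(H₂) → U(H₁ ⊕ H₂)`, reindexing, and their compatibility with `U ↪ Sp`

Topic `NumberTheory/Automorphic`; namespace `Literature.NumberTheory.Automorphic.UnitaryGroup` (fifth part of
`UnitaryGroupSymplecticEmbedding`; generic algebra only — the number-field instances are in
`UnitaryGroupDirectSumCarriers`). Definitions and proved lemmas only: **no named facts, 0 proof holes**.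

For the see-saw `(U(V) × U(V), U(W₁) × U(W₂)) ↔ (U(V), U(W₁ ⊕ W₂))` of [Kudla1984] / [GelbartRogawski1991, §3.2]
one needs, on the GROUP side only: (i) the block-diagonal embedding of symplectic groups of an orthogonal direct
sum, in the coordinates of the Literature's Heisenberg files (`W_T = (ι → K) × (ι → K)`, form `polar β_T`,
`β_T(x, y) = x ⬝ᵥ T y`; direct sum = index `ι₁ ⊕ ι₂`, Gram matrix `fromBlocks T₁ 0 0 T₂`) — `spSum`, §1; (ii) the
transport of `Sp(W_T)` along a reindexing `ι ≃ ι′` — `spReindex`, §2; (iii) the block-diagonal embedding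
`U(σ, H₁) × U(σ, H₂) →* U(σ, fromBlocks H₁ 0 0 H₂)` of unitary groups and its `Fin`-indexed form
`blockDiagFin … →* U(σ, J₁ ⊕ᶠ J₂)`, `J₁ ⊕ᶠ J₂ = finSum J₁ J₂ := reindex finSumFinEquiv finSumFinEquiv (fromBlocks J₁ 0 0 J₂)`
(our adelic carriers are `Fin`-indexed) — §3; (iv) the compatibility of (i)–(iii) with the restriction-of-scalars
embedding `toSymplectic : U(σ, T ⊗ 1) →* Sp(W_T)` of `UnitaryGroupSymplecticEmbedding` and with the Kronecker
(dual-pair) construction: `Res(g₁ ⊕ g₂) = Res g₁ ⊕ Res g₂`, `Res(reindex g) = reindex (Res g)`,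
`T_V ⊗ (T₁ ⊕ T₂) = reindex (T_V ⊗ T₁ ⊕ T_V ⊗ T₂)`, `g ⊗ (u₁ ⊕ u₂) = reindex ((g ⊗ u₁) ⊕ (g ⊗ u₂))` — §4.
Everything is coefficientwise linear algebra over a commutative ring. [folklore] throughout; the dual-pair /
see-saw context is [Kudla1984, §1] and [MoeglinVignerasWaldspurger1987, Ch. 1 I.17–I.19].

References:
* [GelbartRogawski1991] S. Gelbart, J. Rogawski, *L-functions and Fourier–Jacobi coefficients for the unitary
  group U(3)*, Invent. Math. 105 (1991), §3.2.
* [Kudla1984] S. Kudla, *Seesaw dual reductive pairs*, in: Automorphic forms of several variables (Katata 1983),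
  Progr. Math. 46 (1984) 244–268, §1.
* [MoeglinVignerasWaldspurger1987] C. Mœglin, M.-F. Vignéras, J.-L. Waldspurger, LNM 1291, Ch. 1 I.17–I.19.
-/

set_option autoImplicit false

noncomputable section

open Matrix
open scoped Kronecker
open Literature.RepresentationTheory.HeisenbergGroup

namespace Literature.NumberTheory.Automorphic

namespace UnitaryGroup

/-! ## 1. `Sp(W_{T₁}) × Sp(W_{T₂}) →* Sp(W_{T₁ ⊕ T₂})` -/

section SpSum

variable (K : Type*) [CommRing K] (ι₁ ι₂ : Type*) [Fintype ι₁] [Fintype ι₂] [DecidableEq ι₁] [DecidableEq ι₂]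

/-- **`W_{ι₁ ⊕ ι₂} ≃ W_{ι₁} × W_{ι₂}`**: `(x, y) ↦ ((x|₁, y|₁), (x|₂, y|₂))`. [folklore] -/
def sumSplit : ((ι₁ ⊕ ι₂ → K) × (ι₁ ⊕ ι₂ → K)) ≃ₗ[K] (((ι₁ → K) × (ι₁ → K)) × ((ι₂ → K) × (ι₂ → K))) where
  toFun v := ((v.1 ∘ Sum.inl, v.2 ∘ Sum.inl), (v.1 ∘ Sum.inr, v.2 ∘ Sum.inr))
  invFun w := (Sum.elim w.1.1 w.2.1, Sum.elim w.1.2 w.2.2)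
  map_add' _ _ := rfl
  map_smul' _ _ := rfl
  left_inv v := Prod.ext (Sum.elim_comp_inl_inr v.1) (Sum.elim_comp_inl_inr v.2)
  right_inv w := by
    rcases w with ⟨⟨a, b⟩, ⟨a', b'⟩⟩
    rfl

variable {K ι₁ ι₂}

omit [Fintype ι₁] [Fintype ι₂] [DecidableEq ι₁] [DecidableEq ι₂] in
/-- formula. [folklore] -/
@[simp] theorem sumSplit_apply (v : (ι₁ ⊕ ι₂ → K) × (ι₁ ⊕ ι₂ → K)) :
    sumSplit K ι₁ ι₂ v = ((v.1 ∘ Sum.inl, v.2 ∘ Sum.inl), (v.1 ∘ Sum.inr, v.2 ∘ Sum.inr)) := rfl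

omit [Fintype ι₁] [Fintype ι₂] [DecidableEq ι₁] [DecidableEq ι₂] in
/-- formula. [folklore] -/
@[simp] theorem sumSplit_symm_apply (w : ((ι₁ → K) × (ι₁ → K)) × ((ι₂ → K) × (ι₂ → K))) :
    (sumSplit K ι₁ ι₂).symm w = (Sum.elim w.1.1 w.2.1, Sum.elim w.1.2 w.2.2) := rfl

/-- **`β_{T₁ ⊕ T₂} = β_{T₁} ⊕ β_{T₂}`**: `x ⬝ᵥ (fromBlocks T₁ 0 0 T₂) y = x|₁ ⬝ᵥ T₁ y|₁ + x|₂ ⬝ᵥ T₂ y|₂`. [folklore] -/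
theorem toLinearMap₂'_fromBlocks (T₁ : Matrix ι₁ ι₁ K) (T₂ : Matrix ι₂ ι₂ K) (x y : ι₁ ⊕ ι₂ → K) :
    Matrix.toLinearMap₂' K (Matrix.fromBlocks T₁ 0 0 T₂) x y =
      Matrix.toLinearMap₂' K T₁ (x ∘ Sum.inl) (y ∘ Sum.inl) + Matrix.toLinearMap₂' K T₂ (x ∘ Sum.inr) (y ∘ Sum.inr) := by
  rw [Matrix.toLinearMap₂'_apply', Matrix.toLinearMap₂'_apply', Matrix.toLinearMap₂'_apply']
  conv_lhs => rw [← Sum.elim_comp_inl_inr x]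
  rw [Matrix.fromBlocks_mulVec, Matrix.zero_mulVec, Matrix.zero_mulVec, add_zero, zero_add, sumElim_dotProduct_sumElim]

/-- **`g₁ ⊕ g₂`** as an automorphism of `W_{ι₁ ⊕ ι₂}`: `sumSplit⁻¹ ∘ (g₁ × g₂) ∘ sumSplit`. [folklore] -/
def spSumEquiv (g₁ : ((ι₁ → K) × (ι₁ → K)) ≃ₗ[K] ((ι₁ → K) × (ι₁ → K)))
    (g₂ : ((ι₂ → K) × (ι₂ → K)) ≃ₗ[K] ((ι₂ → K) × (ι₂ → K))) :
    ((ι₁ ⊕ ι₂ → K) × (ι₁ ⊕ ι₂ → K)) ≃ₗ[K] ((ι₁ ⊕ ι₂ → K) × (ι₁ ⊕ ι₂ → K)) :=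
  (sumSplit K ι₁ ι₂).trans ((g₁.prodCongr g₂).trans (sumSplit K ι₁ ι₂).symm)

omit [Fintype ι₁] [Fintype ι₂] [DecidableEq ι₁] [DecidableEq ι₂] in
/-- formula: `(g₁ ⊕ g₂)(x, y) = (g₁(x|₁, y|₁).1 ⊔ g₂(x|₂, y|₂).1, g₁(x|₁, y|₁).2 ⊔ g₂(x|₂, y|₂).2)`. [folklore] -/
@[simp] theorem spSumEquiv_apply (g₁ : ((ι₁ → K) × (ι₁ → K)) ≃ₗ[K] ((ι₁ → K) × (ι₁ → K)))
    (g₂ : ((ι₂ → K) × (ι₂ → K)) ≃ₗ[K] ((ι₂ → K) × (ι₂ → K))) (v : (ι₁ ⊕ ι₂ → K) × (ι₁ ⊕ ι₂ → K)) :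
    spSumEquiv g₁ g₂ v =
      (Sum.elim (g₁ (v.1 ∘ Sum.inl, v.2 ∘ Sum.inl)).1 (g₂ (v.1 ∘ Sum.inr, v.2 ∘ Sum.inr)).1,
        Sum.elim (g₁ (v.1 ∘ Sum.inl, v.2 ∘ Sum.inl)).2 (g₂ (v.1 ∘ Sum.inr, v.2 ∘ Sum.inr)).2) := rfl

/-- `(g₁, g₂) ↦ g₁ ⊕ g₂` is a group homomorphism `GL(W₁) × GL(W₂) →* GL(W₁ ⊕ W₂)`. [folklore] -/
def spSumHom : (((ι₁ → K) × (ι₁ → K)) ≃ₗ[K] ((ι₁ → K) × (ι₁ → K))) × (((ι₂ → K) × (ι₂ → K)) ≃ₗ[K] ((ι₂ → K) × (ι₂ → K))) →*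
    (((ι₁ ⊕ ι₂ → K) × (ι₁ ⊕ ι₂ → K)) ≃ₗ[K] ((ι₁ ⊕ ι₂ → K) × (ι₁ ⊕ ι₂ → K))) where
  toFun g := spSumEquiv g.1 g.2
  map_one' := LinearEquiv.ext fun v => by
    simp only [spSumEquiv_apply, Prod.fst_one, Prod.snd_one, LinearEquiv.coe_one, id_eq, Sum.elim_comp_inl_inr]
  map_mul' g g' := LinearEquiv.ext fun v => by
    simp only [spSumEquiv_apply, Prod.fst_mul, Prod.snd_mul, LinearEquiv.mul_apply, Sum.elim_comp_inl, Sum.elim_comp_inr,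
      Prod.mk.eta]

omit [Fintype ι₁] [Fintype ι₂] [DecidableEq ι₁] [DecidableEq ι₂] in
/-- formula. [folklore] -/
@[simp] theorem spSumHom_apply (g : (((ι₁ → K) × (ι₁ → K)) ≃ₗ[K] ((ι₁ → K) × (ι₁ → K))) ×
    (((ι₂ → K) × (ι₂ → K)) ≃ₗ[K] ((ι₂ → K) × (ι₂ → K)))) : spSumHom g = spSumEquiv g.1 g.2 := rfl

/-- **`g₁ ⊕ g₂` is symplectic for `β_{T₁ ⊕ T₂}` when `g_j` is symplectic for `β_{T_j}`.** [folklore] -/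
theorem spSumEquiv_mem {T₁ : Matrix ι₁ ι₁ K} {T₂ : Matrix ι₂ ι₂ K}
    {g₁ : ((ι₁ → K) × (ι₁ → K)) ≃ₗ[K] ((ι₁ → K) × (ι₁ → K))} {g₂ : ((ι₂ → K) × (ι₂ → K)) ≃ₗ[K] ((ι₂ → K) × (ι₂ → K))}
    (hg₁ : g₁ ∈ symplecticGroup (polar (Matrix.toLinearMap₂' K T₁)))
    (hg₂ : g₂ ∈ symplecticGroup (polar (Matrix.toLinearMap₂' K T₂))) :
    spSumEquiv g₁ g₂ ∈ symplecticGroup (polar (Matrix.toLinearMap₂' K (Matrix.fromBlocks T₁ 0 0 T₂))) := by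
  rw [mem_symplecticGroup] at hg₁ hg₂ ⊢
  intro v w
  have h1 := hg₁ (v.1 ∘ Sum.inl, v.2 ∘ Sum.inl) (w.1 ∘ Sum.inl, w.2 ∘ Sum.inl)
  have h2 := hg₂ (v.1 ∘ Sum.inr, v.2 ∘ Sum.inr) (w.1 ∘ Sum.inr, w.2 ∘ Sum.inr)
  simp only [polar_apply] at h1 h2
  simp only [polar_apply, toLinearMap₂'_fromBlocks, spSumEquiv_apply, Sum.elim_comp_inl, Sum.elim_comp_inr]
  linear_combination h1 + h2

/-- **`Sp(W_{T₁}) × Sp(W_{T₂}) →* Sp(W_{T₁ ⊕ T₂})`, `(g₁, g₂) ↦ g₁ ⊕ g₂`** — the symplectic groups of two summands of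
an orthogonal direct sum inside the symplectic group of the sum (the ambient pair of every see-saw). [cite: Kudla1984, §1] -/
def spSum (T₁ : Matrix ι₁ ι₁ K) (T₂ : Matrix ι₂ ι₂ K) :
    symplecticGroup (polar (Matrix.toLinearMap₂' K T₁)) × symplecticGroup (polar (Matrix.toLinearMap₂' K T₂)) →*
      symplecticGroup (polar (Matrix.toLinearMap₂' K (Matrix.fromBlocks T₁ 0 0 T₂))) :=
  (spSumHom.comp ((symplecticGroup (polar (Matrix.toLinearMap₂' K T₁))).subtype.prodMap
      (symplecticGroup (polar (Matrix.toLinearMap₂' K T₂))).subtype)).codRestrict _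
    fun g => spSumEquiv_mem g.1.2 g.2.2

/-- `spSum (g₁, g₂) = g₁ ⊕ g₂` as an automorphism. [folklore] -/
@[simp] theorem coe_spSum (T₁ : Matrix ι₁ ι₁ K) (T₂ : Matrix ι₂ ι₂ K)
    (g : symplecticGroup (polar (Matrix.toLinearMap₂' K T₁)) × symplecticGroup (polar (Matrix.toLinearMap₂' K T₂))) :
    ((spSum T₁ T₂ g : symplecticGroup (polar (Matrix.toLinearMap₂' K (Matrix.fromBlocks T₁ 0 0 T₂)))) :
        ((ι₁ ⊕ ι₂ → K) × (ι₁ ⊕ ι₂ → K)) ≃ₗ[K] ((ι₁ ⊕ ι₂ → K) × (ι₁ ⊕ ι₂ → K))) =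
      spSumEquiv (g.1 : ((ι₁ → K) × (ι₁ → K)) ≃ₗ[K] ((ι₁ → K) × (ι₁ → K)))
        (g.2 : ((ι₂ → K) × (ι₂ → K)) ≃ₗ[K] ((ι₂ → K) × (ι₂ → K))) :=
  rfl

omit [Fintype ι₁] [Fintype ι₂] [DecidableEq ι₁] [DecidableEq ι₂] in
/-- `sumSplit ∘ (g₁ ⊕ g₂) ∘ sumSplit⁻¹ = g₁ × g₂`. [folklore] -/
theorem sumSplit_spSumEquiv (g₁ : ((ι₁ → K) × (ι₁ → K)) ≃ₗ[K] ((ι₁ → K) × (ι₁ → K)))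
    (g₂ : ((ι₂ → K) × (ι₂ → K)) ≃ₗ[K] ((ι₂ → K) × (ι₂ → K))) (w : ((ι₁ → K) × (ι₁ → K)) × ((ι₂ → K) × (ι₂ → K))) :
    sumSplit K ι₁ ι₂ (spSumEquiv g₁ g₂ ((sumSplit K ι₁ ι₂).symm w)) = (g₁ w.1, g₂ w.2) := by
  simp only [spSumEquiv, LinearEquiv.trans_apply, LinearEquiv.apply_symm_apply, LinearEquiv.prodCongr_apply]

omit [Fintype ι₁] [Fintype ι₂] [DecidableEq ι₁] [DecidableEq ι₂] in
/-- `(g₁, g₂) ↦ g₁ ⊕ g₂` is injective. [folklore] -/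
theorem spSumEquiv_injective₂ {g₁ g₁' : ((ι₁ → K) × (ι₁ → K)) ≃ₗ[K] ((ι₁ → K) × (ι₁ → K))}
    {g₂ g₂' : ((ι₂ → K) × (ι₂ → K)) ≃ₗ[K] ((ι₂ → K) × (ι₂ → K))} (h : spSumEquiv g₁ g₂ = spSumEquiv g₁' g₂') :
    g₁ = g₁' ∧ g₂ = g₂' := by
  have key : ∀ w : ((ι₁ → K) × (ι₁ → K)) × ((ι₂ → K) × (ι₂ → K)), (g₁ w.1, g₂ w.2) = (g₁' w.1, g₂' w.2) :=
    fun w => by rw [← sumSplit_spSumEquiv, ← sumSplit_spSumEquiv, h]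
  exact ⟨LinearEquiv.ext fun a => congrArg Prod.fst (key (a, 0)), LinearEquiv.ext fun b => congrArg Prod.snd (key (0, b))⟩

omit [Fintype ι₁] [Fintype ι₂] [DecidableEq ι₁] [DecidableEq ι₂] in
/-- `(g₁, g₂) ↦ g₁ ⊕ g₂` is injective on `GL(W₁) × GL(W₂)`. [folklore] -/
theorem spSumHom_injective : Function.Injective (spSumHom (K := K) (ι₁ := ι₁) (ι₂ := ι₂)) := fun _ _ h =>
  Prod.ext (spSumEquiv_injective₂ h).1 (spSumEquiv_injective₂ h).2

/-- `spSum` is injective. [folklore] -/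
theorem spSum_injective (T₁ : Matrix ι₁ ι₁ K) (T₂ : Matrix ι₂ ι₂ K) : Function.Injective (spSum T₁ T₂) :=
  fun _ _ hgg' => (spSumHom_injective.comp (Subtype.val_injective.prodMap Subtype.val_injective))
    (congrArg (fun k : symplecticGroup (polar (Matrix.toLinearMap₂' K (Matrix.fromBlocks T₁ 0 0 T₂))) =>
      (k : ((ι₁ ⊕ ι₂ → K) × (ι₁ ⊕ ι₂ → K)) ≃ₗ[K] ((ι₁ ⊕ ι₂ → K) × (ι₁ ⊕ ι₂ → K)))) hgg')

end SpSum

/-! ## 2. Reindexing `W_T ≃ W_{reindex e e T}` along `e : ι ≃ ι′` -/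

section SpReindex

variable (K : Type*) [CommRing K] {ι ι' : Type*} [Fintype ι] [Fintype ι'] [DecidableEq ι] [DecidableEq ι']

/-- `(x, y) ↦ (x ∘ e⁻¹, y ∘ e⁻¹)`: `W_ι ≃ W_{ι′}` along `e : ι ≃ ι′`. [folklore] -/
def reindexW (e : ι ≃ ι') : ((ι → K) × (ι → K)) ≃ₗ[K] ((ι' → K) × (ι' → K)) :=
  (LinearEquiv.funCongrLeft K K e.symm).prodCongr (LinearEquiv.funCongrLeft K K e.symm)

variable {K}

omit [Fintype ι] [Fintype ι'] [DecidableEq ι] [DecidableEq ι'] in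
/-- formula. [folklore] -/
@[simp] theorem reindexW_apply (e : ι ≃ ι') (v : (ι → K) × (ι → K)) : reindexW K e v = (v.1 ∘ e.symm, v.2 ∘ e.symm) := rfl

omit [Fintype ι] [Fintype ι'] [DecidableEq ι] [DecidableEq ι'] in
/-- formula. [folklore] -/
@[simp] theorem reindexW_symm_apply (e : ι ≃ ι') (v : (ι' → K) × (ι' → K)) :
    (reindexW K e).symm v = (v.1 ∘ e, v.2 ∘ e) := rfl

/-- **`β_{reindex e e T}(x ∘ e⁻¹, y ∘ e⁻¹) = β_T(x, y)`.** [folklore] -/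
theorem toLinearMap₂'_reindex (e : ι ≃ ι') (T : Matrix ι ι K) (x y : ι → K) :
    Matrix.toLinearMap₂' K (Matrix.reindex e e T) (x ∘ e.symm) (y ∘ e.symm) = Matrix.toLinearMap₂' K T x y := by
  rw [Matrix.toLinearMap₂'_apply', Matrix.toLinearMap₂'_apply', Matrix.reindex_apply, Matrix.submatrix_mulVec_equiv]
  have hy : (y ∘ ⇑e.symm) ∘ ⇑e.symm.symm = y := by
    ext i; simp
  rw [hy]
  exact comp_equiv_dotProduct_comp_equiv _ _ e.symm

/-- **`Sp(W_T) →* Sp(W_{reindex e e T})`, `g ↦ e ∘ g ∘ e⁻¹`** (injective; `symplecticGroupCongr` along `reindexW e`).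
[folklore] -/
def spReindex (e : ι ≃ ι') (T : Matrix ι ι K) :
    symplecticGroup (polar (Matrix.toLinearMap₂' K T)) →*
      symplecticGroup (polar (Matrix.toLinearMap₂' K (Matrix.reindex e e T))) :=
  symplecticGroupCongr _ _ (reindexW K e) fun v w => by
    simp only [polar_apply, reindexW_apply, toLinearMap₂'_reindex]

/-- formula: `spReindex e T g v = e (g (e⁻¹ v))`. [folklore] -/
@[simp] theorem coe_spReindex_apply (e : ι ≃ ι') (T : Matrix ι ι K) (g : symplecticGroup (polar (Matrix.toLinearMap₂' K T)))
    (v : (ι' → K) × (ι' → K)) :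
    ((spReindex e T g : symplecticGroup (polar (Matrix.toLinearMap₂' K (Matrix.reindex e e T)))) :
        ((ι' → K) × (ι' → K)) ≃ₗ[K] ((ι' → K) × (ι' → K))) v =
      reindexW K e ((g : ((ι → K) × (ι → K)) ≃ₗ[K] ((ι → K) × (ι → K))) ((reindexW K e).symm v)) :=
  rfl

/-- `spReindex e T g = e ∘ g ∘ e⁻¹` as an automorphism (`LinearEquiv.trans` form). [folklore] -/
theorem coe_spReindex (e : ι ≃ ι') (T : Matrix ι ι K) (g : symplecticGroup (polar (Matrix.toLinearMap₂' K T))) :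
    ((spReindex e T g : symplecticGroup (polar (Matrix.toLinearMap₂' K (Matrix.reindex e e T)))) :
        ((ι' → K) × (ι' → K)) ≃ₗ[K] ((ι' → K) × (ι' → K))) =
      ((reindexW K e).symm.trans (g : ((ι → K) × (ι → K)) ≃ₗ[K] ((ι → K) × (ι → K)))).trans (reindexW K e) :=
  rfl

omit [CommRing K] [DecidableEq ι] [DecidableEq ι'] [Fintype ι] [Fintype ι'] in
/-- `reindex e e T` is symmetric when `T` is. [folklore] -/
theorem isSymm_reindex (e : ι ≃ ι') {T : Matrix ι ι K} (hT : T.IsSymm) : (Matrix.reindex e e T).IsSymm := by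
  unfold Matrix.IsSymm
  rw [Matrix.transpose_reindex, hT.eq]

/-- `spReindex e T` is injective. [folklore] -/
theorem spReindex_injective (e : ι ≃ ι') (T : Matrix ι ι K) : Function.Injective (spReindex e T) :=
  symplecticGroupCongr_injective _ _ _ _

end SpReindex

/-! ## 3. `U(σ, H₁) × U(σ, H₂) →* U(σ, H₁ ⊕ H₂)` and its `Fin`-indexed form -/

section BlockDiag

variable {S S' : Type*} [CommRing S] [CommRing S'] {n₁ n₂ : Type*} [Fintype n₁] [Fintype n₂] [DecidableEq n₁] [DecidableEq n₂]

/-- **`GL_{n₁}(S) × GL_{n₂}(S) →* GL_{n₁ ⊕ n₂}(S)`, `(g₁, g₂) ↦ diag(g₁, g₂)`.** [folklore] -/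
def blockDiagGL : GL n₁ S × GL n₂ S →* GL (n₁ ⊕ n₂) S where
  toFun g :=
    ⟨Matrix.fromBlocks (g.1 : Matrix n₁ n₁ S) 0 0 (g.2 : Matrix n₂ n₂ S),
      Matrix.fromBlocks ((g.1⁻¹ : GL n₁ S) : Matrix n₁ n₁ S) 0 0 ((g.2⁻¹ : GL n₂ S) : Matrix n₂ n₂ S),
      by simp only [Matrix.fromBlocks_multiply, Matrix.mul_zero, Matrix.zero_mul, add_zero, zero_add, Units.mul_inv,
        Matrix.fromBlocks_one],
      by simp only [Matrix.fromBlocks_multiply, Matrix.mul_zero, Matrix.zero_mul, add_zero, zero_add, Units.inv_mul,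
        Matrix.fromBlocks_one]⟩
  map_one' := Units.ext (by simp only [Prod.fst_one, Prod.snd_one, Units.val_one, Matrix.fromBlocks_one])
  map_mul' g g' := Units.ext (by
    simp only [Prod.fst_mul, Prod.snd_mul, Units.val_mul, Matrix.fromBlocks_multiply, Matrix.mul_zero, Matrix.zero_mul,
      add_zero, zero_add])

/-- matrix of `blockDiagGL (g₁, g₂)`: `fromBlocks g₁ 0 0 g₂`. [folklore] -/
@[simp] theorem coe_blockDiagGL (g : GL n₁ S × GL n₂ S) :
    ((blockDiagGL g : GL (n₁ ⊕ n₂) S) : Matrix (n₁ ⊕ n₂) (n₁ ⊕ n₂) S) =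
      Matrix.fromBlocks (g.1 : Matrix n₁ n₁ S) 0 0 (g.2 : Matrix n₂ n₂ S) :=
  rfl

/-- `blockDiagGL` is injective. [folklore] -/
theorem blockDiagGL_injective : Function.Injective (blockDiagGL (S := S) (n₁ := n₁) (n₂ := n₂)) := by
  intro g g' hgg'
  have h := congrArg (fun k : GL (n₁ ⊕ n₂) S => (k : Matrix (n₁ ⊕ n₂) (n₁ ⊕ n₂) S)) hgg'
  simp only [coe_blockDiagGL, Matrix.fromBlocks_inj] at h
  exact Prod.ext (Units.ext h.1) (Units.ext h.2.2.2)

/-- `blockDiagGL` is continuous (topological ring `S`). [folklore] -/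
theorem continuous_blockDiagGL [TopologicalSpace S] [IsTopologicalRing S] :
    Continuous (blockDiagGL (S := S) (n₁ := n₁) (n₂ := n₂)) := by
  refine Units.continuous_iff.2 ⟨?_, ?_⟩
  · exact ((Units.continuous_val.comp continuous_fst).matrix_fromBlocks continuous_const continuous_const
      (Units.continuous_val.comp continuous_snd))
  · exact ((Units.continuous_coe_inv.comp continuous_fst).matrix_fromBlocks continuous_const continuous_const
      (Units.continuous_coe_inv.comp continuous_snd))

/-- **`diag(g₁, g₂) ∈ U(σ, H₁ ⊕ H₂)` for `g_j ∈ U(σ, H_j)`.** [folklore] -/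
theorem blockDiagGL_mem (σ : S →+* S) {H₁ : Matrix n₁ n₁ S} {H₂ : Matrix n₂ n₂ S} {g₁ : GL n₁ S} {g₂ : GL n₂ S}
    (hg₁ : g₁ ∈ unitaryGroupOfForm σ H₁) (hg₂ : g₂ ∈ unitaryGroupOfForm σ H₂) :
    blockDiagGL (g₁, g₂) ∈ unitaryGroupOfForm σ (Matrix.fromBlocks H₁ 0 0 H₂) := by
  rw [mem_unitaryGroupOfForm_iff] at hg₁ hg₂ ⊢
  rw [coe_blockDiagGL, Matrix.fromBlocks_map, Matrix.fromBlocks_transpose, Matrix.fromBlocks_multiply,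
    Matrix.fromBlocks_multiply]
  simp only [Matrix.map_zero σ (map_zero σ), Matrix.transpose_zero, Matrix.mul_zero, Matrix.zero_mul, add_zero, zero_add,
    hg₁, hg₂]

/-- **`U(σ, H₁) × U(σ, H₂) →* U(σ, H₁ ⊕ H₂)`, `(g₁, g₂) ↦ diag(g₁, g₂)`** — the isometry groups of two hermitian
spaces inside that of their orthogonal sum (the `U(W₁) × U(W₂) ⊂ U(W₁ ⊕ W₂)` of the see-saw). [cite: Kudla1984, §1] -/
def blockDiag (σ : S →+* S) (H₁ : Matrix n₁ n₁ S) (H₂ : Matrix n₂ n₂ S) :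
    unitaryGroupOfForm σ H₁ × unitaryGroupOfForm σ H₂ →* unitaryGroupOfForm σ (Matrix.fromBlocks H₁ 0 0 H₂) :=
  (blockDiagGL.comp ((unitaryGroupOfForm σ H₁).subtype.prodMap (unitaryGroupOfForm σ H₂).subtype)).codRestrict _
    fun g => blockDiagGL_mem σ g.1.2 g.2.2

/-- matrix of `blockDiag (g₁, g₂)`. [folklore] -/
@[simp] theorem coe_blockDiag (σ : S →+* S) (H₁ : Matrix n₁ n₁ S) (H₂ : Matrix n₂ n₂ S)
    (g : unitaryGroupOfForm σ H₁ × unitaryGroupOfForm σ H₂) :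
    (((blockDiag σ H₁ H₂ g : unitaryGroupOfForm σ (Matrix.fromBlocks H₁ 0 0 H₂)) : GL (n₁ ⊕ n₂) S) :
        Matrix (n₁ ⊕ n₂) (n₁ ⊕ n₂) S) =
      Matrix.fromBlocks ((g.1 : GL n₁ S) : Matrix n₁ n₁ S) 0 0 ((g.2 : GL n₂ S) : Matrix n₂ n₂ S) :=
  rfl

/-- `blockDiag (g₁, g₂) = blockDiagGL (g₁, g₂)` in `GL`. [folklore] -/
theorem coe_blockDiag_eq (σ : S →+* S) (H₁ : Matrix n₁ n₁ S) (H₂ : Matrix n₂ n₂ S)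
    (g : unitaryGroupOfForm σ H₁ × unitaryGroupOfForm σ H₂) :
    ((blockDiag σ H₁ H₂ g : unitaryGroupOfForm σ (Matrix.fromBlocks H₁ 0 0 H₂)) : GL (n₁ ⊕ n₂) S) =
      blockDiagGL ((g.1 : GL n₁ S), (g.2 : GL n₂ S)) :=
  rfl

/-- `blockDiag` is injective. [folklore] -/
theorem blockDiag_injective (σ : S →+* S) (H₁ : Matrix n₁ n₁ S) (H₂ : Matrix n₂ n₂ S) :
    Function.Injective (blockDiag σ H₁ H₂) :=
  fun _ _ hgg' => (blockDiagGL_injective.comp (Subtype.val_injective.prodMap Subtype.val_injective))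
    (congrArg (fun k : unitaryGroupOfForm σ (Matrix.fromBlocks H₁ 0 0 H₂) => (k : GL (n₁ ⊕ n₂) S)) hgg')

/-- `blockDiag` is continuous. [folklore] -/
theorem continuous_blockDiag [TopologicalSpace S] [IsTopologicalRing S] (σ : S →+* S) (H₁ : Matrix n₁ n₁ S)
    (H₂ : Matrix n₂ n₂ S) : Continuous (blockDiag σ H₁ H₂) :=
  Continuous.subtype_mk (continuous_blockDiagGL.comp
    ((continuous_subtype_val.comp continuous_fst).prodMk (continuous_subtype_val.comp continuous_snd))) _

/-- `diag(g₁, 1)` and `diag(1, g₂)` commute. [folklore] -/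
theorem commute_blockDiag_inl_inr (σ : S →+* S) (H₁ : Matrix n₁ n₁ S) (H₂ : Matrix n₂ n₂ S)
    (g₁ : unitaryGroupOfForm σ H₁) (g₂ : unitaryGroupOfForm σ H₂) :
    Commute (blockDiag σ H₁ H₂ (g₁, 1)) (blockDiag σ H₁ H₂ (1, g₂)) := by
  rw [Commute, SemiconjBy, ← map_mul, ← map_mul, Prod.mk_mul_mk, Prod.mk_mul_mk, one_mul, mul_one, one_mul, mul_one]

omit [Fintype n₁] [Fintype n₂] [DecidableEq n₁] [DecidableEq n₂] in
/-- `(fromBlocks H₁ 0 0 H₂).map f = fromBlocks (H₁.map f) 0 0 (H₂.map f)` for a ring hom `f`. [folklore] -/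
theorem fromBlocks_diag_map (f : S →+* S') (H₁ : Matrix n₁ n₁ S) (H₂ : Matrix n₂ n₂ S) :
    (Matrix.fromBlocks H₁ 0 0 H₂).map f = Matrix.fromBlocks (H₁.map f) 0 0 (H₂.map f) := by
  rw [Matrix.fromBlocks_map, Matrix.map_zero f (map_zero f), Matrix.map_zero f (map_zero f)]

/-- `GL(f) (diag(g₁, g₂)) = diag(GL(f) g₁, GL(f) g₂)`. [folklore] -/
theorem map_blockDiagGL (f : S →+* S') (g : GL n₁ S × GL n₂ S) :
    Matrix.GeneralLinearGroup.map f (blockDiagGL g) =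
      blockDiagGL (Matrix.GeneralLinearGroup.map f g.1, Matrix.GeneralLinearGroup.map f g.2) :=
  Units.ext (by
    change (Matrix.fromBlocks (g.1 : Matrix n₁ n₁ S) 0 0 (g.2 : Matrix n₂ n₂ S)).map f = _
    rw [fromBlocks_diag_map]; rfl)

/-! ### The `Fin`-indexed direct sum `J₁ ⊕ᶠ J₂` -/

variable (N₁ N₂ : ℕ)

/-- **`J₁ ⊕ᶠ J₂ := reindex finSumFinEquiv finSumFinEquiv (fromBlocks J₁ 0 0 J₂) : Matrix (Fin (N₁ + N₂)) (Fin (N₁ + N₂)) S`**,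
the Gram matrix of the orthogonal direct sum in the concatenated `Fin` basis. [folklore] -/
def finSum (J₁ : Matrix (Fin N₁) (Fin N₁) S) (J₂ : Matrix (Fin N₂) (Fin N₂) S) : Matrix (Fin (N₁ + N₂)) (Fin (N₁ + N₂)) S :=
  Matrix.reindex finSumFinEquiv finSumFinEquiv (Matrix.fromBlocks J₁ 0 0 J₂)

variable {N₁ N₂}

/-- `(J₁ ⊕ᶠ J₂).submatrix finSumFinEquiv finSumFinEquiv = fromBlocks J₁ 0 0 J₂`. [folklore] -/
@[simp] theorem finSum_submatrix (J₁ : Matrix (Fin N₁) (Fin N₁) S) (J₂ : Matrix (Fin N₂) (Fin N₂) S) :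
    (finSum N₁ N₂ J₁ J₂).submatrix finSumFinEquiv finSumFinEquiv = Matrix.fromBlocks J₁ 0 0 J₂ := by
  rw [finSum, Matrix.reindex_apply, Matrix.submatrix_submatrix, Equiv.symm_comp_self, Matrix.submatrix_id_id]

/-- `(J₁ ⊕ᶠ J₂).map f = (J₁.map f) ⊕ᶠ (J₂.map f)`. [folklore] -/
theorem finSum_map (f : S →+* S') (J₁ : Matrix (Fin N₁) (Fin N₁) S) (J₂ : Matrix (Fin N₂) (Fin N₂) S) :
    (finSum N₁ N₂ J₁ J₂).map f = finSum N₁ N₂ (J₁.map f) (J₂.map f) := by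
  rw [finSum, finSum, Matrix.reindex_apply, Matrix.reindex_apply, ← Matrix.submatrix_map, fromBlocks_diag_map]

/-- `J₁ ⊕ᶠ J₂` is symmetric when `J₁, J₂` are. [folklore] -/
theorem isSymm_finSum {J₁ : Matrix (Fin N₁) (Fin N₁) S} {J₂ : Matrix (Fin N₂) (Fin N₂) S} (h₁ : J₁.IsSymm) (h₂ : J₂.IsSymm) :
    (finSum N₁ N₂ J₁ J₂).IsSymm := by
  unfold Matrix.IsSymm
  rw [finSum, Matrix.transpose_reindex, Matrix.fromBlocks_transpose]
  simp only [Matrix.transpose_zero, h₁.eq, h₂.eq]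

/-- `fromBlocks T₁ 0 0 T₂` is symmetric when `T₁, T₂` are. [folklore] -/
theorem isSymm_fromBlocks_diag {m₁ m₂ : Type*} {T₁ : Matrix m₁ m₁ S} {T₂ : Matrix m₂ m₂ S} (h₁ : T₁.IsSymm)
    (h₂ : T₂.IsSymm) : (Matrix.fromBlocks T₁ 0 0 T₂).IsSymm := by
  unfold Matrix.IsSymm
  rw [Matrix.fromBlocks_transpose]
  simp only [Matrix.transpose_zero, h₁.eq, h₂.eq]

/-- **`GL_m(S) →* GL_n(S)` along `e : m ≃ n`** (reindex rows and columns; no topology needed). [folklore] -/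
def reindexGL {m n : Type*} [Fintype m] [DecidableEq m] [Fintype n] [DecidableEq n] (e : m ≃ n) : GL m S →* GL n S :=
  (Units.mapEquiv (Matrix.reindexRingEquiv S e).toMulEquiv).toMonoidHom

/-- matrix of `reindexGL e g`: `reindex e e g`. [folklore] -/
@[simp] theorem coe_reindexGL {m n : Type*} [Fintype m] [DecidableEq m] [Fintype n] [DecidableEq n] (e : m ≃ n)
    (g : GL m S) : ((reindexGL e g : GL n S) : Matrix n n S) = Matrix.reindex e e (g : Matrix m m S) := rfl

/-- `reindexGL e` is injective. [folklore] -/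
theorem reindexGL_injective {m n : Type*} [Fintype m] [DecidableEq m] [Fintype n] [DecidableEq n] (e : m ≃ n) :
    Function.Injective (reindexGL (S := S) e) :=
  (Units.mapEquiv (Matrix.reindexRingEquiv S e).toMulEquiv).injective

/-- `reindexGL e` is continuous. [folklore] -/
theorem continuous_reindexGL [TopologicalSpace S] [IsTopologicalRing S] {m n : Type*} [Fintype m] [DecidableEq m]
    [Fintype n] [DecidableEq n] (e : m ≃ n) : Continuous (reindexGL (S := S) e) := by
  refine Units.continuous_iff.2 ⟨?_, ?_⟩
  · exact (Units.continuous_val.matrix_submatrix _ _)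
  · exact (Units.continuous_coe_inv.matrix_submatrix _ _)

/-- `GL(f) (reindexGL e g) = reindexGL e (GL(f) g)`. [folklore] -/
theorem map_reindexGL {m n : Type*} [Fintype m] [DecidableEq m] [Fintype n] [DecidableEq n] (f : S →+* S') (e : m ≃ n)
    (g : GL m S) :
    Matrix.GeneralLinearGroup.map f (reindexGL e g) = reindexGL e (Matrix.GeneralLinearGroup.map f g) :=
  Units.ext (by
    change (Matrix.reindex e e (g : Matrix m m S)).map f = Matrix.reindex e e ((g : Matrix m m S).map f)
    rw [Matrix.reindex_apply, Matrix.reindex_apply, Matrix.submatrix_map])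

/-- `reindexGL e g ∈ U(σ, reindex e e H) ↔ g ∈ U(σ, H)`. [folklore] -/
theorem reindexGL_mem_iff (σ : S →+* S) {m n : Type*} [Fintype m] [DecidableEq m] [Fintype n] [DecidableEq n]
    (e : m ≃ n) (H : Matrix m m S) (g : GL m S) :
    reindexGL e g ∈ unitaryGroupOfForm σ (Matrix.reindex e e H) ↔ g ∈ unitaryGroupOfForm σ H := by
  rw [mem_unitaryGroupOfForm_iff, mem_unitaryGroupOfForm_iff, coe_reindexGL]
  have h1 : ((Matrix.reindex e e (g : Matrix m m S)).map σ)ᵀ * Matrix.reindex e e H *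
        Matrix.reindex e e (g : Matrix m m S) =
      Matrix.reindex e e (((g : Matrix m m S).map σ)ᵀ * H * (g : Matrix m m S)) := by
    simp only [Matrix.reindex_apply, ← Matrix.submatrix_map, Matrix.transpose_submatrix, Matrix.submatrix_mul_equiv]
  rw [h1]
  exact (Matrix.reindex e e).injective.eq_iff

/-- **`U(σ, J₁) × U(σ, J₂) →* U(σ, J₁ ⊕ᶠ J₂)`**, `(g₁, g₂) ↦ reindex (diag(g₁, g₂))` — the see-saw's `U(W₁) × U(W₂) ⊂
U(W₁ ⊕ W₂)` on `Fin`-indexed carriers. [cite: Kudla1984, §1] -/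
def blockDiagFin (σ : S →+* S) (J₁ : Matrix (Fin N₁) (Fin N₁) S) (J₂ : Matrix (Fin N₂) (Fin N₂) S) :
    unitaryGroupOfForm σ J₁ × unitaryGroupOfForm σ J₂ →* unitaryGroupOfForm σ (finSum N₁ N₂ J₁ J₂) :=
  ((reindexGL finSumFinEquiv).comp (blockDiagGL.comp
      ((unitaryGroupOfForm σ J₁).subtype.prodMap (unitaryGroupOfForm σ J₂).subtype))).codRestrict _
    fun g => (reindexGL_mem_iff σ finSumFinEquiv _ _).2 (blockDiagGL_mem σ g.1.2 g.2.2)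

/-- matrix of `blockDiagFin (g₁, g₂)`: `reindex finSumFinEquiv finSumFinEquiv (fromBlocks g₁ 0 0 g₂)`. [folklore] -/
@[simp] theorem coe_blockDiagFin (σ : S →+* S) (J₁ : Matrix (Fin N₁) (Fin N₁) S) (J₂ : Matrix (Fin N₂) (Fin N₂) S)
    (g : unitaryGroupOfForm σ J₁ × unitaryGroupOfForm σ J₂) :
    (((blockDiagFin σ J₁ J₂ g : unitaryGroupOfForm σ (finSum N₁ N₂ J₁ J₂)) : GL (Fin (N₁ + N₂)) S) :
        Matrix (Fin (N₁ + N₂)) (Fin (N₁ + N₂)) S) =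
      Matrix.reindex finSumFinEquiv finSumFinEquiv
        (Matrix.fromBlocks ((g.1 : GL (Fin N₁) S) : Matrix (Fin N₁) (Fin N₁) S) 0 0
          ((g.2 : GL (Fin N₂) S) : Matrix (Fin N₂) (Fin N₂) S)) :=
  rfl

/-- `blockDiagFin (g₁, g₂) = reindexGL (blockDiagGL (g₁, g₂))` in `GL`. [folklore] -/
theorem coe_blockDiagFin_eq (σ : S →+* S) (J₁ : Matrix (Fin N₁) (Fin N₁) S) (J₂ : Matrix (Fin N₂) (Fin N₂) S)
    (g : unitaryGroupOfForm σ J₁ × unitaryGroupOfForm σ J₂) :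
    ((blockDiagFin σ J₁ J₂ g : unitaryGroupOfForm σ (finSum N₁ N₂ J₁ J₂)) : GL (Fin (N₁ + N₂)) S) =
      reindexGL finSumFinEquiv (blockDiagGL ((g.1 : GL (Fin N₁) S), (g.2 : GL (Fin N₂) S))) :=
  rfl

/-- `blockDiagFin` is injective. [folklore] -/
theorem blockDiagFin_injective (σ : S →+* S) (J₁ : Matrix (Fin N₁) (Fin N₁) S) (J₂ : Matrix (Fin N₂) (Fin N₂) S) :
    Function.Injective (blockDiagFin σ J₁ J₂) :=
  fun _ _ hgg' => (((reindexGL_injective (S := S) finSumFinEquiv).comp blockDiagGL_injective).comp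
      (Subtype.val_injective.prodMap Subtype.val_injective))
    (congrArg (fun k : unitaryGroupOfForm σ (finSum N₁ N₂ J₁ J₂) => (k : GL (Fin (N₁ + N₂)) S)) hgg')

/-- `blockDiagFin` is continuous. [folklore] -/
theorem continuous_blockDiagFin [TopologicalSpace S] [IsTopologicalRing S] (σ : S →+* S)
    (J₁ : Matrix (Fin N₁) (Fin N₁) S) (J₂ : Matrix (Fin N₂) (Fin N₂) S) : Continuous (blockDiagFin σ J₁ J₂) :=
  Continuous.subtype_mk ((continuous_reindexGL _).comp (continuous_blockDiagGL.comp
    ((continuous_subtype_val.comp continuous_fst).prodMk (continuous_subtype_val.comp continuous_snd)))) _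

/-- `blockDiagFin (g₁, 1)` and `blockDiagFin (1, g₂)` commute. [folklore] -/
theorem commute_blockDiagFin_inl_inr (σ : S →+* S) (J₁ : Matrix (Fin N₁) (Fin N₁) S) (J₂ : Matrix (Fin N₂) (Fin N₂) S)
    (g₁ : unitaryGroupOfForm σ J₁) (g₂ : unitaryGroupOfForm σ J₂) :
    Commute (blockDiagFin σ J₁ J₂ (g₁, 1)) (blockDiagFin σ J₁ J₂ (1, g₂)) := by
  rw [Commute, SemiconjBy, ← map_mul, ← map_mul, Prod.mk_mul_mk, Prod.mk_mul_mk, one_mul, mul_one, one_mul, mul_one]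

/-- **Functoriality in the ring**: `U(f) (blockDiagFin (g₁, g₂)) = blockDiagFin (U(f) g₁, U(f) g₂)` for `f ∘ σ = τ ∘ f`
(underlying `GL` statement; used with `f = (E ↪ 𝔸_E)`: rational points go to rational points). [folklore] -/
theorem map_coe_blockDiagFin {σ : S →+* S} (f : S →+* S') (J₁ : Matrix (Fin N₁) (Fin N₁) S)
    (J₂ : Matrix (Fin N₂) (Fin N₂) S) (g : unitaryGroupOfForm σ J₁ × unitaryGroupOfForm σ J₂) :
    Matrix.GeneralLinearGroup.map f
        ((blockDiagFin σ J₁ J₂ g : unitaryGroupOfForm σ (finSum N₁ N₂ J₁ J₂)) : GL (Fin (N₁ + N₂)) S) =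
      reindexGL finSumFinEquiv (blockDiagGL (Matrix.GeneralLinearGroup.map f (g.1 : GL (Fin N₁) S),
        Matrix.GeneralLinearGroup.map f (g.2 : GL (Fin N₂) S))) := by
  rw [coe_blockDiagFin_eq, map_reindexGL, map_blockDiagGL]

end BlockDiag

/-! ## 4. Compatibility with restriction of scalars `U ↪ Sp` and with the Kronecker (dual-pair) construction -/

section Compat

variable {R S : Type*} [CommRing R] [CommRing S] {φ : R →+* S} {Ψ : (R × R) ≃+ S} {δ : S} {d : R}
variable {n₁ n₂ : Type*} [Fintype n₁] [Fintype n₂] [DecidableEq n₁] [DecidableEq n₂]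

/-- **`Res(diag(g₁, g₂)) = Res g₁ ⊕ Res g₂`**: restriction of scalars commutes with block-diagonal sums
(as automorphisms of `R^{n₁ ⊕ n₂} × R^{n₁ ⊕ n₂}`). [folklore] -/
theorem IsQuadraticCoordinates.resAut_blockDiagGL (h : IsQuadraticCoordinates φ Ψ δ d) (g : GL n₁ S × GL n₂ S) :
    h.resAut (n₁ ⊕ n₂) (blockDiagGL g) = spSumEquiv (h.resAut n₁ g.1) (h.resAut n₂ g.2) := by
  refine LinearEquiv.ext fun v => ?_
  obtain ⟨a, b⟩ := v
  rw [spSumEquiv_apply, h.resAut_apply_mk, h.resAut_apply_mk, h.resAut_apply_mk, coe_blockDiagGL, Matrix.fromBlocks_map,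
    Matrix.fromBlocks_map, Matrix.map_zero _ (map_zero _), Matrix.map_zero _ (map_zero _), Matrix.map_zero _ (map_zero _),
    Matrix.map_zero _ (map_zero _)]
  simp only [Matrix.fromBlocks_mulVec, Matrix.zero_mulVec, add_zero, zero_add]
  refine Prod.ext (funext fun i => ?_) (funext fun i => ?_) <;> cases i <;> rfl

/-- **`toSymplectic (diag(g₁, g₂)) = spSum (toSymplectic g₁, toSymplectic g₂)`**: the square
`U(H₁) × U(H₂) → U(H₁ ⊕ H₂) → Sp(W₁ ⊕ W₂)` = `U(H₁) × U(H₂) → Sp(W₁) × Sp(W₂) → Sp(W₁ ⊕ W₂)` commutes. [folklore] -/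
theorem IsQuadraticCoordinates.toSymplectic_blockDiag (h : IsQuadraticCoordinates φ Ψ δ d) {T₁ : Matrix n₁ n₁ R}
    {T₂ : Matrix n₂ n₂ R} (hT₁ : T₁.IsSymm) (hT₂ : T₂.IsSymm) {σ : S →+* S} (hσφ : ∀ a, σ (φ a) = φ a) (hσδ : σ δ = -δ)
    {H₁ : Matrix n₁ n₁ S} {H₂ : Matrix n₂ n₂ S} (hH₁ : H₁ = T₁.map φ) (hH₂ : H₂ = T₂.map φ)
    (g : unitaryGroupOfForm σ H₁ × unitaryGroupOfForm σ H₂) :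
    h.toSymplectic (n₁ ⊕ n₂) (isSymm_fromBlocks_diag hT₁ hT₂) hσφ hσδ
        (show Matrix.fromBlocks H₁ 0 0 H₂ = (Matrix.fromBlocks T₁ 0 0 T₂).map φ by rw [hH₁, hH₂, fromBlocks_diag_map])
        (blockDiag σ H₁ H₂ g) =
      spSum T₁ T₂ (h.toSymplectic n₁ hT₁ hσφ hσδ hH₁ g.1, h.toSymplectic n₂ hT₂ hσφ hσδ hH₂ g.2) :=
  Subtype.ext (h.resAut_blockDiagGL ((g.1 : GL n₁ S), (g.2 : GL n₂ S)))

variable {n n' : Type*} [Fintype n] [Fintype n'] [DecidableEq n] [DecidableEq n']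

omit [Fintype n] [Fintype n'] [DecidableEq n] [DecidableEq n'] [CommRing S] in
/-- `(reindex e e A).map f = reindex e e (A.map f)`. [folklore] -/
theorem reindex_map {S' : Type*} (f : S → S') (e : n ≃ n') (A : Matrix n n S) :
    (Matrix.reindex e e A).map f = Matrix.reindex e e (A.map f) := rfl

/-- **`Res(reindex g) = reindex (Res g)`**: `resAut (reindexGL e g) = e ∘ resAut g ∘ e⁻¹`. [folklore] -/
theorem IsQuadraticCoordinates.resAut_reindexGL (h : IsQuadraticCoordinates φ Ψ δ d) (e : n ≃ n') (g : GL n S) :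
    h.resAut n' (reindexGL e g) = ((reindexW R e).symm.trans (h.resAut n g)).trans (reindexW R e) := by
  refine LinearEquiv.ext fun v => ?_
  obtain ⟨a, b⟩ := v
  rw [LinearEquiv.trans_apply, LinearEquiv.trans_apply, reindexW_symm_apply, reindexW_apply, h.resAut_apply_mk,
    h.resAut_apply_mk, coe_reindexGL, reindex_map, reindex_map, Matrix.reindex_apply, Matrix.reindex_apply,
    Matrix.submatrix_mulVec_equiv, Matrix.submatrix_mulVec_equiv, Matrix.submatrix_mulVec_equiv,
    Matrix.submatrix_mulVec_equiv, Equiv.symm_symm]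
  rfl

/-- **`U(σ, H) →* U(σ, reindex e e H)`**, `g ↦ reindex e e g` (relabelling the basis). [folklore] -/
def reindexU (σ : S →+* S) (e : n ≃ n') (H : Matrix n n S) :
    unitaryGroupOfForm σ H →* unitaryGroupOfForm σ (Matrix.reindex e e H) :=
  ((reindexGL e).comp (unitaryGroupOfForm σ H).subtype).codRestrict _ fun g => (reindexGL_mem_iff σ e H g).2 g.2

/-- `reindexU g = reindexGL g` in `GL`. [folklore] -/
@[simp] theorem coe_reindexU (σ : S →+* S) (e : n ≃ n') (H : Matrix n n S) (g : unitaryGroupOfForm σ H) :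
    ((reindexU σ e H g : unitaryGroupOfForm σ (Matrix.reindex e e H)) : GL n' S) = reindexGL e (g : GL n S) := rfl

/-- `reindexU` is injective. [folklore] -/
theorem reindexU_injective (σ : S →+* S) (e : n ≃ n') (H : Matrix n n S) : Function.Injective (reindexU σ e H) :=
  fun _ _ hgg' => Subtype.ext (reindexGL_injective e (congrArg
    (fun k : unitaryGroupOfForm σ (Matrix.reindex e e H) => (k : GL n' S)) hgg'))

/-- `reindexU` is continuous. [folklore] -/
theorem continuous_reindexU [TopologicalSpace S] [IsTopologicalRing S] (σ : S →+* S) (e : n ≃ n') (H : Matrix n n S) :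
    Continuous (reindexU σ e H) :=
  Continuous.subtype_mk ((continuous_reindexGL e).comp continuous_subtype_val) _

/-- **`toSymplectic (reindex g) = spReindex (toSymplectic g)`**: relabelling the basis commutes with `U ↪ Sp`.
[folklore] -/
theorem IsQuadraticCoordinates.toSymplectic_reindexU (h : IsQuadraticCoordinates φ Ψ δ d) {T : Matrix n n R}
    (hT : T.IsSymm) {σ : S →+* S} (hσφ : ∀ a, σ (φ a) = φ a) (hσδ : σ δ = -δ) {H : Matrix n n S} (hH : H = T.map φ)
    (e : n ≃ n') (g : unitaryGroupOfForm σ H) :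
    h.toSymplectic n' (T := Matrix.reindex e e T) (isSymm_reindex e hT) hσφ hσδ
        (show Matrix.reindex e e H = (Matrix.reindex e e T).map φ by rw [hH, reindex_map]) (reindexU σ e H g) =
      spReindex e T (h.toSymplectic n hT hσφ hσδ hH g) :=
  Subtype.ext (h.resAut_reindexGL e (g : GL n S))

/-! ### Kronecker products with block-diagonal matrices -/

variable {m₁ m₂ : Type*} [Fintype m₁] [Fintype m₂] [DecidableEq m₁] [DecidableEq m₂]

omit [Fintype n] [DecidableEq n] [Fintype m₁] [Fintype m₂] [DecidableEq m₁] [DecidableEq m₂] in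
/-- **`A ⊗ (B₁ ⊕ B₂) = (A ⊗ B₁) ⊕ (A ⊗ B₂)`** after the relabelling
`n × (m₁ ⊕ m₂) ≃ (n × m₁) ⊕ (n × m₂)` (`Equiv.prodSumDistrib`). [folklore] -/
theorem reindex_kronecker_fromBlocks_diag (A : Matrix n n S) (B₁ : Matrix m₁ m₁ S) (B₂ : Matrix m₂ m₂ S) :
    Matrix.reindex (Equiv.prodSumDistrib n m₁ m₂) (Equiv.prodSumDistrib n m₁ m₂) (A ⊗ₖ Matrix.fromBlocks B₁ 0 0 B₂) =
      Matrix.fromBlocks (A ⊗ₖ B₁) 0 0 (A ⊗ₖ B₂) := by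
  ext i j
  rcases i with ⟨a, b⟩ | ⟨a, b⟩ <;> rcases j with ⟨a', b'⟩ | ⟨a', b'⟩ <;>
    simp [Matrix.kroneckerMap_apply]

/-- **`g ⊗ diag(u₁, u₂) = diag(g ⊗ u₁, g ⊗ u₂)`** in `GL` after the relabelling `Equiv.prodSumDistrib`. [folklore] -/
theorem reindexGL_kroneckerGL_blockDiagGL (g : GL n S) (u : GL m₁ S × GL m₂ S) :
    reindexGL (Equiv.prodSumDistrib n m₁ m₂) (kroneckerGL (g, blockDiagGL u)) =
      blockDiagGL (kroneckerGL (g, u.1), kroneckerGL (g, u.2)) :=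
  Units.ext (by
    rw [coe_reindexGL, coe_kroneckerGL, coe_blockDiagGL, coe_blockDiagGL, coe_kroneckerGL, coe_kroneckerGL]
    exact reindex_kronecker_fromBlocks_diag _ _ _)

/-- **`g ⊗ 1_{m₁ ⊕ m₂} = diag(g ⊗ 1_{m₁}, g ⊗ 1_{m₂})`** in `GL` after the relabelling (the `U(V)`-side of the
see-saw: `U(V)` acts diagonally on `V ⊗ (W₁ ⊕ W₂) = (V ⊗ W₁) ⊕ (V ⊗ W₂)`). [folklore] -/
theorem reindexGL_kroneckerGL_one (g : GL n S) :
    reindexGL (Equiv.prodSumDistrib n m₁ m₂) (kroneckerGL (g, (1 : GL (m₁ ⊕ m₂) S))) =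
      blockDiagGL (kroneckerGL (g, (1 : GL m₁ S)), kroneckerGL (g, (1 : GL m₂ S))) := by
  rw [← reindexGL_kroneckerGL_blockDiagGL g ((1 : GL m₁ S), (1 : GL m₂ S)), ← Prod.one_eq_mk, map_one]

/-- **The see-saw identity for restriction of scalars** (both squares at once): for `g ∈ GL(V)`, `u_j ∈ GL(W_j)`,
`e ∘ Res(g ⊗ diag(u₁, u₂)) ∘ e⁻¹ = Res(g ⊗ u₁) ⊕ Res(g ⊗ u₂)` with `e = Equiv.prodSumDistrib`
(as automorphisms of `R^{(n × m₁) ⊕ (n × m₂)} × R^{(n × m₁) ⊕ (n × m₂)}`). With `u = 1` this is the `U(V)`-side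
square (`U(V)` diagonal in `Sp(𝕎₁) × Sp(𝕎₂)`), with `g = 1` the `U(W₁) × U(W₂)`-side square. [cite: Kudla1984, §1] -/
theorem IsQuadraticCoordinates.resAut_kroneckerGL_blockDiagGL (h : IsQuadraticCoordinates φ Ψ δ d) (g : GL n S)
    (u : GL m₁ S × GL m₂ S) :
    ((reindexW R (Equiv.prodSumDistrib n m₁ m₂)).symm.trans (h.resAut (n × (m₁ ⊕ m₂)) (kroneckerGL (g, blockDiagGL u)))).trans
        (reindexW R (Equiv.prodSumDistrib n m₁ m₂)) =
      spSumEquiv (h.resAut (n × m₁) (kroneckerGL (g, u.1))) (h.resAut (n × m₂) (kroneckerGL (g, u.2))) := by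
  rw [← h.resAut_reindexGL, reindexGL_kroneckerGL_blockDiagGL, h.resAut_blockDiagGL]

/-- **The see-saw squares on `pairToSymplectic`** (`H_• = T_• ⊗ 1`): for `G = g ⊗ diag(u₁, u₂) ∈ U(σ, H_V ⊗ (H₁ ⊕ H₂))`,
`spReindex e (pairToSymplectic[V, W₁ ⊕ W₂] G) = spSum (pairToSymplectic[V, W₁] (g ⊗ u₁), pairToSymplectic[V, W₂] (g ⊗ u₂))`
as automorphisms of the common symplectic space (the two sides live in `Sp` of the Gram matrices
`reindex e e (T_V ⊗ (T₁ ⊕ T₂))` and `(T_V ⊗ T₁) ⊕ (T_V ⊗ T₂)`, which are equal by `reindex_kronecker_fromBlocks_diag`).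
[cite: Kudla1984, §1] -/
theorem IsQuadraticCoordinates.pairToSymplectic_dualPair_blockDiag (h : IsQuadraticCoordinates φ Ψ δ d)
    {TV : Matrix n n R} {T₁ : Matrix m₁ m₁ R} {T₂ : Matrix m₂ m₂ R} (hV : TV.IsSymm) (h₁ : T₁.IsSymm) (h₂ : T₂.IsSymm)
    {σ : S →+* S} (hσφ : ∀ a, σ (φ a) = φ a) (hσδ : σ δ = -δ) {HV : Matrix n n S} {H₁ : Matrix m₁ m₁ S}
    {H₂ : Matrix m₂ m₂ S} (hHV : HV = TV.map φ) (hH₁ : H₁ = T₁.map φ) (hH₂ : H₂ = T₂.map φ)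
    (g : unitaryGroupOfForm σ HV) (u : unitaryGroupOfForm σ H₁ × unitaryGroupOfForm σ H₂) :
    ((spReindex (Equiv.prodSumDistrib n m₁ m₂) (TV ⊗ₖ Matrix.fromBlocks T₁ 0 0 T₂)
          (h.pairToSymplectic hV (isSymm_fromBlocks_diag h₁ h₂) hσφ hσδ hHV
            (show Matrix.fromBlocks H₁ 0 0 H₂ = (Matrix.fromBlocks T₁ 0 0 T₂).map φ by rw [hH₁, hH₂, fromBlocks_diag_map])
            (dualPair σ HV (Matrix.fromBlocks H₁ 0 0 H₂) (g, blockDiag σ H₁ H₂ u))) :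
        symplecticGroup (polar (Matrix.toLinearMap₂' R
          (Matrix.reindex (Equiv.prodSumDistrib n m₁ m₂) (Equiv.prodSumDistrib n m₁ m₂)
            (TV ⊗ₖ Matrix.fromBlocks T₁ 0 0 T₂))))) :
        (((n × m₁) ⊕ (n × m₂) → R) × ((n × m₁) ⊕ (n × m₂) → R)) ≃ₗ[R]
          (((n × m₁) ⊕ (n × m₂) → R) × ((n × m₁) ⊕ (n × m₂) → R))) =
      ((spSum (TV ⊗ₖ T₁) (TV ⊗ₖ T₂)
          (h.pairToSymplectic hV h₁ hσφ hσδ hHV hH₁ (dualPair σ HV H₁ (g, u.1)),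
            h.pairToSymplectic hV h₂ hσφ hσδ hHV hH₂ (dualPair σ HV H₂ (g, u.2))) :
        symplecticGroup (polar (Matrix.toLinearMap₂' R (Matrix.fromBlocks (TV ⊗ₖ T₁) 0 0 (TV ⊗ₖ T₂))))) :
        (((n × m₁) ⊕ (n × m₂) → R) × ((n × m₁) ⊕ (n × m₂) → R)) ≃ₗ[R]
          (((n × m₁) ⊕ (n × m₂) → R) × ((n × m₁) ⊕ (n × m₂) → R))) := by
  rw [coe_spReindex, coe_spSum]
  exact h.resAut_kroneckerGL_blockDiagGL (g : GL n S) ((u.1 : GL m₁ S), (u.2 : GL m₂ S))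

end Compat

end UnitaryGroup

end Literature.NumberTheory.Automorphic

end
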